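import Summits.HodgeConjecture.HodgeCM.PerL34.ArchCOrbitTheta_1

/-! PORT of `HodgeCM/PerL34/ArchCOrbitTheta.lean` (HodgeCMPerL run 82) — part 2: continuation of `Summits.HodgeConjecture.HodgeCM.PerL34.ArchCOrbitTheta_1` (split at a top-level declaration boundary by port_pkg.py; scope re-opened below; declarations unchanged). -/

-- port_pkg: scope re-opened for this part (file-level context, then the namespace/section stack open at the cut)
set_option autoImplicit false
noncomputable section
open scoped Topology
open Filter
namespace HodgeCM
namespace PerL34
namespace ArchC
open HodgeCM.Prior.Perl34File HodgeCM.Prior.Perl34File.Perl34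
section Bridge
open HodgeCM.PerL34.Fock HodgeCM.PerL34.Fock.PrintDict
variable {H HG CG G SK SigIdx SigIdxG : Type*}
variable [NormedAddCommGroup H] [InnerProductSpace ℂ H] [CompleteSpace H]
variable [NormedAddCommGroup HG] [InnerProductSpace ℂ HG] [CompleteSpace HG]
variable [NormedAddCommGroup CG] [NormedSpace ℂ CG]
variable [Group G] [TopologicalSpace G] [TopologicalSpace SK]
namespace FockThetaBridge
variable {C : IsolationCore H HG CG G SK SigIdx SigIdxG} {D : TorusData C} {P : C4a.PointedCore C}
/-- **Lemma 4.1(c) over the theta bridge**: [SETUP D5‴] (theta vector C¹ under R, L²) in place of `hF`, no D7,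
everything else kernel / [D4] / [DEFINITIONAL]. -/
theorem H_occ (B : FockThetaBridge C D P) :
    ∀ (Φ : SK) (i : SigIdx), (∃ v ∈ C.hatσ i, C.TΦ Φ v ≠ 0) → D.wOccurs i :=
  B.toScalarBridge.H_occ

/-- **Operator-norm bridge ⇒ theta bridge** (KERNEL: `thetaC1` from `hF` by `hasDerivAt_rieszTheta_of_hF`; so
[SETUP D5‴] is implied by the operator-norm input [SETUP D5] of `FockOrbitBridge` / `FockAnalyticBridge`). -/
def ofOrbit (B : FockOrbitBridge C D P) : FockThetaBridge C D P :=
  letI : AddCommGroup SK := B.instSKacg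
  letI : Module ℂ SK := B.instSKmod
  { pl := B.pl
    ιT := B.ιT
    w := B.w
    w_norm := B.w_norm
    w_loc := B.w_loc
    instSKacg := B.instSKacg
    instSKmod := B.instSKmod
    TΦc_add := B.TΦc_add
    TΦc_smul := B.TΦc_smul
    cont := B.cont
    FinIdx := B.FinIdx
    ins := B.ins
    dense := B.dense
    omg_ins := B.omg_ins
    invariance := B.invariance
    ιR := B.ιR
    XR := B.XR
    e := B.e
    ladder_span := B.ladder_span
    thetaC1 := fun j f φ p => hasDerivAt_rieszTheta_of_hF B.invariance (B.e j) (B.hF j f φ p)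
    wOccurs_of_eigenvector := B.wOccurs_of_eigenvector }

/-- (Ported verbatim from the HodgeCMPerL package; no docstring in the source.) -/
theorem ofOrbit_pl (B : FockOrbitBridge C D P) : (ofOrbit B).pl = B.pl ∧ (ofOrbit B).w = B.w := ⟨rfl, rfl⟩

/-- **Fréchet-smooth bridge + operator-norm continuity of Φ ↦ 𝒯_Φ ⇒ theta bridge** (KERNEL:
`hasDerivAt_rieszTheta_of_tendsto_slope`).  So [SETUP D5‴] is also implied by [SETUP D5′] together with the operator
form of [SETUP D4] (`hTc`, tex l. 517) — it sits between the printed ω-side input and the scalar `hFpt`. -/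
def ofSmooth (B : FockSmoothBridge C D P)
    (hTc : Continuous fun Φ : SK => C.TΦc Φ) : FockThetaBridge C D P :=
  letI : AddCommGroup SK := B.instSKacg
  letI : Module ℂ SK := B.instSKmod
  { pl := B.pl
    ιT := B.ιT
    w := B.w
    w_norm := B.w_norm
    w_loc := B.w_loc
    instSKacg := B.instSKacg
    instSKmod := B.instSKmod
    TΦc_add := B.TΦc_add
    TΦc_smul := B.TΦc_smul
    cont := B.cont
    FinIdx := B.FinIdx
    ins := B.ins
    dense := B.dense
    omg_ins := B.omg_ins
    invariance := B.invariance
    ιR := B.ιR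
    XR := B.XR
    e := B.e
    ladder_span := B.ladder_span
    thetaC1 := fun j f φ p =>
      hasDerivAt_rieszTheta_of_tendsto_slope B.TΦc_add B.TΦc_smul hTc B.invariance (p := p) (B.e j) (B.smooth j f φ)
    wOccurs_of_eigenvector := B.wOccurs_of_eigenvector }

/-- (Ported verbatim from the HodgeCMPerL package; no docstring in the source.) -/
theorem ofSmooth_pl (B : FockSmoothBridge C D P) (hTc : Continuous fun Φ : SK => C.TΦc Φ) :
    (ofSmooth B hTc).pl = B.pl ∧ (ofSmooth B hTc).w = B.w := ⟨rfl, rfl⟩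

end FockThetaBridge

/-- **The S4 input over the PRINTED places, theta-vector form** = `PrintedScalarSide` with `hFpt` replaced by
`thetaC1`. -/
structure PrintedThetaSide (C : IsolationCore H HG CG G SK SigIdx SigIdxG) (D : TorusData C)
    (P : C4a.PointedCore C) (RP : Type) [Fintype RP] [DecidableEq RP] (kind : RP → PlaceKind)
    (lam : RP → ℂ) (hlam : ∀ b, lam b ≠ 0) (vac : RP → (Circle × Circle →* Circle)) where
  /-- [SETUP D4] T(L₀⊗ℝ) = ∏_b T_b ⊂ U(W)(𝔸) = `G`. -/
  ιT : (printPlaces RP kind lam hlam vac).Tg →* G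
  /-- [SETUP D4] the additive group structure of 𝒮^κ. -/
  [instSKacg : AddCommGroup SK]
  /-- [SETUP D4] the ℂ-vector-space structure of 𝒮^κ. -/
  [instSKmod : Module ℂ SK]
  /-- [SETUP D4] Φ ↦ 𝒯_Φ is additive. -/
  TΦc_add : ∀ Φ Ψ : SK, C.TΦc (Φ + Ψ) = C.TΦc Φ + C.TΦc Ψ
  /-- [SETUP D4] Φ ↦ 𝒯_Φ is homogeneous. -/
  TΦc_smul : ∀ (c : ℂ) (Φ : SK), C.TΦc (c • Φ) = c • C.TΦc Φ
  /-- [SETUP D4] Φ ↦ 𝒯_Φ(v)(g) is continuous on 𝒮^κ. -/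
  cont : ∀ (p : P.Pt) (v : H), Continuous fun Φ : SK => P.evalPt p (C.TΦc Φ v)
  /-- [SETUP D4] index of the fixed finite data Φ_f. -/
  FinIdx : Type
  /-- [SETUP D4] φ ↦ φ ⊗ Φ_f, linear. -/
  ins : FinIdx → (printPlaces RP kind lam hlam vac).F →ₗ[ℂ] SK
  /-- [SETUP D4/D5] the pure tensors span a dense subspace of 𝒮^κ. -/
  dense : Dense (Submodule.span ℂ
    (Set.range fun q : FinIdx × (printPlaces RP kind lam hlam vac).F => ins q.1 q.2) : Set SK)
  /-- [SETUP D4] ω(t)(φ ⊗ Φ_f) = (ω_∞(t)φ) ⊗ Φ_f. -/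
  omg_ins : ∀ (f : FinIdx) (t : (printPlaces RP kind lam hlam vac).Tg) (φ : (printPlaces RP kind lam hlam vac).F),
    C.omg (ιT t) (ins f φ) = ins f ((printPlaces RP kind lam hlam vac).ωT t φ)
  /-- [NODE N21] 𝒯_{ω(h)Φ}(R(h)v) = 𝒯_Φ(v). -/
  invariance : ∀ (h : G) (Φ : SK) (v : H), C.TΦc (C.omg h Φ) (C.R h v) = C.TΦc Φ v
  /-- [SETUP D5] index of a family of real directions. -/
  ιR : Type
  /-- [SETUP D5] ω_∞(X_j) on 𝓕^κ_∞. -/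
  XR : ιR → (printPlaces RP kind lam hlam vac).F →ₗ[ℂ] (printPlaces RP kind lam hlam vac).F
  /-- [SETUP D4] the curves e_j. -/
  e : ιR → ℝ → G
  /-- [SETUP D5] ladder operators are complex combinations of the real directions. -/
  ladder_span : ∀ k : (printPlaces RP kind lam hlam vac).ιX,
    (printPlaces RP kind lam hlam vac).X k ∈ Submodule.span ℂ (Set.range XR)
  /-- [SETUP D5‴, THETA VECTOR C¹ UNDER R] (verbatim `FockThetaBridge.thetaC1`; print warrant as there). -/
  thetaC1 : ∀ (j : ιR) (f : FinIdx) (φ : (printPlaces RP kind lam hlam vac).F) (p : P.Pt),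
    HasDerivAt (fun s : ℝ => C.R (e j s) (rieszTheta C P p (ins f φ))) (rieszTheta C P p (ins f (XR j φ))) 0
  /-- [DEFINITIONAL] meaning of `TorusData.wOccurs`, with the printed `w`. -/
  wOccurs_of_eigenvector : ∀ i : SigIdx,
    (∃ y ∈ C.hatσ i, y ≠ 0 ∧ ∀ t : (printPlaces RP kind lam hlam vac).Tg,
      C.R (ιT t) y = printPlacesW RP kind lam hlam vac t • y) → D.wOccurs i

section Printed

variable {C : IsolationCore H HG CG G SK SigIdx SigIdxG} {D : TorusData C} {P : C4a.PointedCore C}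
variable {RP : Type} [Fintype RP] [DecidableEq RP] {kind : RP → PlaceKind} {lam : RP → ℂ} {hlam : ∀ b, lam b ≠ 0}
variable {vac : RP → (Circle × Circle →* Circle)}

/-- The theta bridge from the printed-places theta side. -/
def PrintedThetaSide.toThetaBridge (A : PrintedThetaSide C D P RP kind lam hlam vac) : FockThetaBridge C D P :=
  letI : AddCommGroup SK := A.instSKacg
  letI : Module ℂ SK := A.instSKmod
  { pl := printPlaces RP kind lam hlam vac
    ιT := A.ιT
    w := printPlacesW RP kind lam hlam vac
    w_norm := printPlacesW_norm RP kind lam hlam vac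
    w_loc := printPlacesW_loc RP kind lam hlam vac
    instSKacg := A.instSKacg
    instSKmod := A.instSKmod
    TΦc_add := A.TΦc_add
    TΦc_smul := A.TΦc_smul
    cont := A.cont
    FinIdx := A.FinIdx
    ins := A.ins
    dense := A.dense
    omg_ins := A.omg_ins
    invariance := A.invariance
    ιR := A.ιR
    XR := A.XR
    e := A.e
    ladder_span := A.ladder_span
    thetaC1 := A.thetaC1
    wOccurs_of_eigenvector := A.wOccurs_of_eigenvector }

/-- (Ported verbatim from the HodgeCMPerL package; no docstring in the source.) -/
theorem PrintedThetaSide.toThetaBridge_pl (A : PrintedThetaSide C D P RP kind lam hlam vac) :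
    A.toThetaBridge.pl = printPlaces RP kind lam hlam vac ∧
      A.toThetaBridge.w = printPlacesW RP kind lam hlam vac := ⟨rfl, rfl⟩

/-- The printed scalar side from the printed theta side (KERNEL, `hasDerivAt_pointValue_of_thetaC1`). -/
def PrintedThetaSide.toScalarSide (A : PrintedThetaSide C D P RP kind lam hlam vac) :
    PrintedScalarSide C D P RP kind lam hlam vac :=
  letI : AddCommGroup SK := A.instSKacg
  letI : Module ℂ SK := A.instSKmod
  { ιT := A.ιT
    instSKacg := A.instSKacg
    instSKmod := A.instSKmod
    TΦc_add := A.TΦc_add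
    TΦc_smul := A.TΦc_smul
    cont := A.cont
    FinIdx := A.FinIdx
    ins := A.ins
    dense := A.dense
    omg_ins := A.omg_ins
    invariance := A.invariance
    ιR := A.ιR
    XR := A.XR
    e := A.e
    ladder_span := A.ladder_span
    hFpt := fun j f φ p v =>
      hasDerivAt_pointValue_of_thetaC1 A.invariance (A.e j) (A.thetaC1 j f φ p) v
    wOccurs_of_eigenvector := A.wOccurs_of_eigenvector }

/-- **Lemma 4.1(c) over the printed places, with [SETUP D5‴] (theta vector C¹ under R) in place of `hF` and no
[SETUP D7].** -/
theorem PrintedThetaSide.H_occ (A : PrintedThetaSide C D P RP kind lam hlam vac) :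
    ∀ (Φ : SK) (i : SigIdx), (∃ v ∈ C.hatσ i, C.TΦ Φ v ≠ 0) → D.wOccurs i :=
  A.toThetaBridge.H_occ

end Printed

end Bridge

end ArchC

/-! ## §2  Model level -/

section Model

open HodgeCM.Prior.Perl34File HodgeCM.Prior.Perl34File.Perl34 HodgeCM.PerL34.ArchC

variable {U : Universe}

/-- **`Open_occ` from theta bridges in every good context**: node N29 with the last analytic dictionary entry on the
automorphic side (theta vectors are C¹ vectors of R in L², [SETUP D5‴]) and without the Gårding package. -/
theorem Open_occ_of_fockThetaBridges (T : U.ThetaModel)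
    (Pc : ∀ {L : CMField} {ι₁ : L →+* ℂ} (V : HermSpace3 L ι₁) (c : SeesawCtx L),
      C4a.PointedCore (T.core V c))
    (B12 : ∀ {L : CMField} {ι₁ : L →+* ℂ} (V : HermSpace3 L ι₁) (c : SeesawCtx L),
      T.GoodCtx ι₁ c → Nonempty (FockThetaBridge (T.core V c) (T.t12 V c) (Pc V c)))
    (B34 : ∀ {L : CMField} {ι₁ : L →+* ℂ} (V : HermSpace3 L ι₁) (c : SeesawCtx L),
      T.GoodCtx ι₁ c → Nonempty (FockThetaBridge (T.core V c) (T.t34 V c) (Pc V c))) :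
    T.Open_occ :=
  Open_occ_of_fockScalarBridges T Pc (fun V c hc => (B12 V c hc).map FockThetaBridge.toScalarBridge)
    (fun V c hc => (B34 V c hc).map FockThetaBridge.toScalarBridge)

/-- **N29 BY NAME from theta bridges** (carver `N29_occ`). -/
theorem N29_occ_of_fockThetaBridges (T : U.ThetaModel)
    (Pc : ∀ {L : CMField} {ι₁ : L →+* ℂ} (V : HermSpace3 L ι₁) (c : SeesawCtx L),
      C4a.PointedCore (T.core V c))
    (B12 : ∀ {L : CMField} {ι₁ : L →+* ℂ} (V : HermSpace3 L ι₁) (c : SeesawCtx L),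
      T.GoodCtx ι₁ c → Nonempty (FockThetaBridge (T.core V c) (T.t12 V c) (Pc V c)))
    (B34 : ∀ {L : CMField} {ι₁ : L →+* ℂ} (V : HermSpace3 L ι₁) (c : SeesawCtx L),
      T.GoodCtx ι₁ c → Nonempty (FockThetaBridge (T.core V c) (T.t34 V c) (Pc V c))) :
    N29_occ T :=
  (N29_iff T).mpr (Open_occ_of_fockThetaBridges T Pc B12 B34)

end Model

end PerL34
end HodgeCM

end
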